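import Summits.SmoothPoincare4.SmoothPoincare4.Theorems.ConvexBisectionAcyclicBisectionExistsBeltTubeCurves
import HarnessLib

/-!
# Framed isotopies of knots inside a tube of the boundary, II: the isotopy and its framing family
(node T3c-1 `node_belt_isotopic_pushoff` of the sub-goal T3 of stub `stub_steinRealisation` (NF6), line
`modp-braid-orbits`, crux `ConvexBisection.AcyclicBisectionExists`, item stmt-SmoothPoincare4-10508;
wave 3, worker Z5, lead c5; tool for stage (3d))

Continuation of `…BeltTubeCurves.lean` (tube curves `θ ↦ Φ (uDir b θ, w t θ)` of a tube `Φ` of `∂W` are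
smooth embeddings).  Here: the curves form a `KnotIsotopyInBoundary` (`tubeCurveIsotopy`) and the velocities
**`d/dε|₀ Φ (uDir b θ, w t θ + ε ζ t θ)`** (`tubeCurveFraming`, `ζ ≠ 0`) form a framing family carried along it
(`isFramingAlong_tubeCurve`): continuity into `TW` by `continuous_mk_mfderiv_family`, tangency to `∂W` since
the arcs lie in `∂W` (`d(∂W ↪ W) = (u ↦ (0,u))`), transversality since `d(tube-point map)` is injective on the
unit tube and the velocity has non-zero core component (`d/ds uDir b (circlePt s) ≠ 0`) while the framing is
vertical with fibre component `ζ ≠ 0`.  Registered helper `helper_belt_tubeCurves`.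

Everything is proved; no named facts.

## References
* A. A. Kosinski, *Differential Manifolds*, Academic Press (1993), III §3, VI §6. [Kosinski1993]
-/

noncomputable section

-- the prescribed namespace `Summit.<P>.<Sub>.…` duplicates `SmoothPoincare4` (P = Sub)
set_option linter.dupNamespace false

open scoped Manifold ContDiff Topology
open Set Function Metric Filter Bundle

namespace Summit.SmoothPoincare4.SmoothPoincare4.Theorems.AcyclicBisectionExists.ModpBraidOrbits

open Literature.Topology.FourManifolds Literature.Geometry.Symplectic

variable {W : Type} [TopologicalSpace W] [T2Space W] [ChartedSpace (EuclideanHalfSpace 4) W]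
  [IsManifold (𝓡∂ 4) ∞ W] (Φ : CircleTube ↥((𝓡∂ 4).boundary W)) (b : Bool)
  {w ζ : ℝ → sphere (0 : EuclideanSpace ℝ (Fin 2)) 1 → EuclideanSpace ℝ (Fin 2)}
  (hw : ContMDiff (𝓘(ℝ, ℝ).prod (𝓡 1)) 𝓘(ℝ, EuclideanSpace ℝ (Fin 2)) ∞
    fun p : ℝ × (sphere (0 : EuclideanSpace ℝ (Fin 2)) 1) => w p.1 p.2)
  (hζ : ContMDiff (𝓘(ℝ, ℝ).prod (𝓡 1)) 𝓘(ℝ, EuclideanSpace ℝ (Fin 2)) ∞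
    fun p : ℝ × (sphere (0 : EuclideanSpace ℝ (Fin 2)) 1) => ζ p.1 p.2)
  (hw1 : ∀ t θ, ‖w t θ‖ < 1) (hζ0 : ∀ t θ, ζ t θ ≠ 0)

/-! ### §3 The isotopy and its framing family -/

/-- **The tube curves of a fibre family form an isotopy of knots in `∂W`.** [cite: Kosinski1993, III §3] -/
def tubeCurveIsotopy : KnotIsotopyInBoundary (tubeCurve Φ b w 0) (tubeCurve Φ b w 1) where
  toFun := tubeCurve Φ b w
  contMDiff := contMDiff_tubeCurve_uncurry Φ b hw hw1
  isSmoothEmbedding t := isSmoothEmbedding_tubeCurve Φ b hw hw1 t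
  map_zero := rfl
  map_one := rfl
  isBoundaryPoint _ _ _ := tubePt_mem_boundary Φ _

/-- Stages of the tube-curve isotopy. [folklore] -/
@[simp] theorem tubeCurveIsotopy_toFun (t : ℝ) :
    (tubeCurveIsotopy Φ b hw hw1).toFun t = tubeCurve Φ b w t := rfl

include hζ in
omit [T2Space W] in
/-- Each stage `θ ↦ ζ t θ` is smooth. [folklore] -/
theorem contMDiff_stage' (t : ℝ) : ContMDiff (𝓡 1) 𝓘(ℝ, EuclideanSpace ℝ (Fin 2)) ∞ (ζ t) :=
  hζ.comp (contMDiff_const.prodMk contMDiff_id)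

include hw hζ hw1 in
omit [T2Space W] in
/-- **The tube-curve framings are continuous into `TW`, jointly in `(t, θ)`.** [folklore] -/
theorem continuous_tubeCurveFraming_uncurry :
    Continuous fun p : ℝ × (sphere (0 : EuclideanSpace ℝ (Fin 2)) 1) =>
      (TotalSpace.mk' (EuclideanSpace ℝ (Fin 4)) (tubeCurve Φ b w p.1 p.2) (tubeCurveFraming Φ b w ζ p.1 p.2) :
        TangentBundle (𝓡∂ 4) W) := by
  set G : (ℝ × (sphere (0 : EuclideanSpace ℝ (Fin 2)) 1)) × ℝ → W := fun z =>
    tubePt Φ (uDir b z.1.2, w z.1.1 z.1.2 + z.2 • ζ z.1.1 z.1.2) with hG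
  set O : Set ((ℝ × (sphere (0 : EuclideanSpace ℝ (Fin 2)) 1)) × ℝ) :=
    {z | ‖w z.1.1 z.1.2 + z.2 • ζ z.1.1 z.1.2‖ < 1} with hO
  have hlin : ContMDiff ((𝓘(ℝ, ℝ).prod (𝓡 1)).prod 𝓘(ℝ, ℝ)) 𝓘(ℝ, EuclideanSpace ℝ (Fin 2)) ∞
      fun z : (ℝ × (sphere (0 : EuclideanSpace ℝ (Fin 2)) 1)) × ℝ => w z.1.1 z.1.2 + z.2 • ζ z.1.1 z.1.2 :=
    (hw.comp contMDiff_fst).add (contMDiff_snd.smul (hζ.comp contMDiff_fst))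
  have hOo : IsOpen O := isOpen_lt (continuous_norm.comp hlin.continuous) continuous_const
  have h0 : ∀ p : ℝ × (sphere (0 : EuclideanSpace ℝ (Fin 2)) 1), ((p, (0 : ℝ)) : _ × ℝ) ∈ O := fun p => by
    show ‖w p.1 p.2 + (0 : ℝ) • ζ p.1 p.2‖ < 1
    rw [zero_smul, add_zero]; exact hw1 p.1 p.2
  have hGs : ContMDiffOn ((𝓘(ℝ, ℝ).prod (𝓡 1)).prod 𝓘(ℝ, ℝ)) (𝓡∂ 4) ∞ G O := by
    have hs : ContMDiff ((𝓘(ℝ, ℝ).prod (𝓡 1)).prod 𝓘(ℝ, ℝ)) ((𝓡 1).prod 𝓘(ℝ, EuclideanSpace ℝ (Fin 2))) ∞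
        fun z : (ℝ × (sphere (0 : EuclideanSpace ℝ (Fin 2)) 1)) × ℝ =>
          ((uDir b z.1.2, w z.1.1 z.1.2 + z.2 • ζ z.1.1 z.1.2) :
            (sphere (0 : EuclideanSpace ℝ (Fin 2)) 1) × EuclideanSpace ℝ (Fin 2)) :=
      ((contMDiff_uDir b).comp (contMDiff_snd.comp contMDiff_fst)).prodMk hlin
    exact (contMDiffOn_tubePt Φ).comp hs.contMDiffOn fun z hz => Φ.mem_source_iff.2 hz
  have hc := continuous_mk_mfderiv_family (IX := 𝓘(ℝ, ℝ).prod (𝓡 1)) G hOo h0 hGs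
  refine hc.congr fun p => tangentBundle_mk_eq ?_ rfl
  show tubePt Φ (uDir b p.2, w p.1 p.2 + (0 : ℝ) • ζ p.1 p.2) = tubePt Φ (uDir b p.2, w p.1 p.2)
  rw [zero_smul, add_zero]

include hw1 in
omit [T2Space W] in
/-- **The tube-curve framing is tangent to `∂W`** (the arc lies in `∂W`). [folklore] -/
theorem tubeCurveFraming_apply_zero (t : ℝ) (θ : sphere (0 : EuclideanSpace ℝ (Fin 2)) 1) :
    tubeCurveFraming Φ b w ζ t θ ∈ boundaryTangentSpace := by
  -- the arc in `∂W` and its inclusion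
  have hev : ∀ᶠ ε : ℝ in 𝓝 0, ‖w t θ + ε • ζ t θ‖ < 1 := by
    have hc : Continuous fun ε : ℝ => ‖w t θ + ε • ζ t θ‖ := by fun_prop
    exact hc.continuousAt.eventually_lt continuousAt_const (by simpa using hw1 t θ)
  have hγ : ContMDiffAt 𝓘(ℝ, ℝ) (𝓡 3) ∞ (fun ε : ℝ => Φ.toHomeo (uDir b θ, w t θ + ε • ζ t θ)) 0 := by
    have hl : ContMDiff 𝓘(ℝ, ℝ) ((𝓡 1).prod 𝓘(ℝ, EuclideanSpace ℝ (Fin 2))) ∞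
        fun ε : ℝ => ((uDir b θ, w t θ + ε • ζ t θ) : (sphere (0 : EuclideanSpace ℝ (Fin 2)) 1) × EuclideanSpace ℝ (Fin 2)) :=
      contMDiff_const.prodMk (contMDiff_const.add (contMDiff_id.smul contMDiff_const))
    have hq0 : ((uDir b θ, w t θ + (0 : ℝ) • ζ t θ) : (sphere (0 : EuclideanSpace ℝ (Fin 2)) 1) × EuclideanSpace ℝ (Fin 2)) ∈
        Φ.toHomeo.source := Φ.mem_source_iff.2 (by rw [zero_smul, add_zero]; exact hw1 t θ)
    have e : (fun ε : ℝ => Φ.toHomeo (uDir b θ, w t θ + ε • ζ t θ)) = Φ.toHomeo ∘ fun ε : ℝ =>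
        ((uDir b θ, w t θ + ε • ζ t θ) : (sphere (0 : EuclideanSpace ℝ (Fin 2)) 1) × EuclideanSpace ℝ (Fin 2)) := rfl
    rw [e]
    exact (Φ.contMDiffAt_toHomeo hq0).comp 0 (hl 0)
  have hγd := hγ.mdifferentiableAt (by simp)
  have h2 := hasMFDerivAt_incl_boundaryData (n := 3) (W := W) (Φ.toHomeo (uDir b θ, w t θ + (0 : ℝ) • ζ t θ))
  have hc := h2.comp (0 : ℝ) hγd.hasMFDerivAt
  have e : tubeCurveFraming Φ b w ζ t θ =
      consZeroL 3 (mfderiv 𝓘(ℝ, ℝ) (𝓡 3) (fun ε : ℝ => Φ.toHomeo (uDir b θ, w t θ + ε • ζ t θ)) 0 (1 : ℝ)) :=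
    congrArg (fun L : ℝ →L[ℝ] EuclideanSpace ℝ (Fin 4) => L 1) hc.mfderiv
  rw [e, mem_boundaryTangentSpace_iff]
  exact consZeroL_apply_zero _

include hw hw1 hζ0 in
omit [T2Space W] in
/-- **The tube-curve framing is nowhere tangent to the tube curve**: through the injective differential of
the tube-point map, the velocity has a non-zero core component while the framing is vertical.
[cite: Kosinski1993, VI §6] -/
theorem tubeCurveFraming_not_mem_span (t s : ℝ) :
    tubeCurveFraming Φ b w ζ t (circlePt s) ∉ ℝ ∙ knotVelocity (tubeCurve Φ b w t) s := by
  haveI := Fact.mk (@finrank_euclideanSpace_fin ℝ _ 2)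
  set θ : sphere (0 : EuclideanSpace ℝ (Fin 2)) 1 := circlePt s with hθ
  set q : (sphere (0 : EuclideanSpace ℝ (Fin 2)) 1) × EuclideanSpace ℝ (Fin 2) := (uDir b θ, w t θ) with hq
  have hqs : q ∈ Φ.toHomeo.source := Φ.mem_source_iff.2 (hw1 t θ)
  set L := mfderiv ((𝓡 1).prod 𝓘(ℝ, EuclideanSpace ℝ (Fin 2))) (𝓡∂ 4) (tubePt Φ) q with hL
  have hLinj : Injective L := injective_mfderiv_tubePt Φ hqs
  have hPd : MDifferentiableAt ((𝓡 1).prod 𝓘(ℝ, EuclideanSpace ℝ (Fin 2))) (𝓡∂ 4) (tubePt Φ) q :=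
    ((contMDiffOn_tubePt Φ).contMDiffAt (Φ.isOpen_source.mem_nhds hqs)).mdifferentiableAt (by simp)
  -- the fibre section along the parametrisation and the vertical arc
  set σ : ℝ → (sphere (0 : EuclideanSpace ℝ (Fin 2)) 1) × EuclideanSpace ℝ (Fin 2) :=
    fun s' => (uDir b (circlePt s'), w t (circlePt s')) with hσ
  set α : ℝ → (sphere (0 : EuclideanSpace ℝ (Fin 2)) 1) × EuclideanSpace ℝ (Fin 2) :=
    fun ε => (uDir b θ, w t θ + ε • ζ t θ) with hα
  have hσs : ContMDiff 𝓘(ℝ, ℝ) ((𝓡 1).prod 𝓘(ℝ, EuclideanSpace ℝ (Fin 2))) ∞ σ :=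
    (contMDiff_fibreSection b hw t).comp contMDiff_circlePt
  have hαs : ContMDiff 𝓘(ℝ, ℝ) ((𝓡 1).prod 𝓘(ℝ, EuclideanSpace ℝ (Fin 2))) ∞ α :=
    contMDiff_const.prodMk (contMDiff_const.add (contMDiff_id.smul contMDiff_const))
  have hσ0 : σ s = q := rfl
  have hα0 : α 0 = q := by simp [hα, hq]
  -- velocity and framing through `L`
  have hvel : knotVelocity (tubeCurve Φ b w t) s = L (mfderiv 𝓘(ℝ, ℝ) ((𝓡 1).prod 𝓘(ℝ, EuclideanSpace ℝ (Fin 2))) σ s 1) := by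
    have hc := mfderiv_comp s (hσ0 ▸ hPd) ((hσs s).mdifferentiableAt (by simp))
    exact congrArg (fun T : ℝ →L[ℝ] EuclideanSpace ℝ (Fin 4) => T 1) hc
  have hfr : tubeCurveFraming Φ b w ζ t θ = L (mfderiv 𝓘(ℝ, ℝ) ((𝓡 1).prod 𝓘(ℝ, EuclideanSpace ℝ (Fin 2))) α 0 1) := by
    have hc := mfderiv_comp (0 : ℝ) (hα0 ▸ hPd) ((hαs 0).mdifferentiableAt (by simp))
    have e : mfderiv 𝓘(ℝ, ℝ) (𝓡∂ 4) (tubePt Φ ∘ α) 0 1 =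
        mfderiv ((𝓡 1).prod 𝓘(ℝ, EuclideanSpace ℝ (Fin 2))) (𝓡∂ 4) (tubePt Φ) (α 0)
          (mfderiv 𝓘(ℝ, ℝ) ((𝓡 1).prod 𝓘(ℝ, EuclideanSpace ℝ (Fin 2))) α 0 1) :=
      congrArg (fun T : ℝ →L[ℝ] EuclideanSpace ℝ (Fin 4) => T 1) hc
    have key : ∀ (q' : (sphere (0 : EuclideanSpace ℝ (Fin 2)) 1) × EuclideanSpace ℝ (Fin 2)) (_ : q' = q)
        (v : TangentSpace ((𝓡 1).prod 𝓘(ℝ, EuclideanSpace ℝ (Fin 2))) q'),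
        mfderiv ((𝓡 1).prod 𝓘(ℝ, EuclideanSpace ℝ (Fin 2))) (𝓡∂ 4) (tubePt Φ) q' v = L v := by
      intro q' e' v; subst e'; rfl
    rw [key _ hα0] at e
    exact e
  -- first components: the velocity's is the velocity of `uDir b ∘ circlePt` (non-zero), the framing's is `0`
  have hfst : ContMDiff ((𝓡 1).prod 𝓘(ℝ, EuclideanSpace ℝ (Fin 2))) 𝓘(ℝ, EuclideanSpace ℝ (Fin 2)) ∞
      fun q' : (sphere (0 : EuclideanSpace ℝ (Fin 2)) 1) × EuclideanSpace ℝ (Fin 2) => ((q'.1 : EuclideanSpace ℝ (Fin 2))) :=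
    contMDiff_coe_sphere.comp contMDiff_fst
  have hfst_d : ∀ p, MDifferentiableAt ((𝓡 1).prod 𝓘(ℝ, EuclideanSpace ℝ (Fin 2))) 𝓘(ℝ, EuclideanSpace ℝ (Fin 2))
      (fun q' : (sphere (0 : EuclideanSpace ℝ (Fin 2)) 1) × EuclideanSpace ℝ (Fin 2) => ((q'.1 : EuclideanSpace ℝ (Fin 2)))) p :=
    fun p => (hfst p).mdifferentiableAt (by simp)
  set Tfst := mfderiv ((𝓡 1).prod 𝓘(ℝ, EuclideanSpace ℝ (Fin 2))) 𝓘(ℝ, EuclideanSpace ℝ (Fin 2))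
    (fun q' : (sphere (0 : EuclideanSpace ℝ (Fin 2)) 1) × EuclideanSpace ℝ (Fin 2) => ((q'.1 : EuclideanSpace ℝ (Fin 2)))) q
    with hTfst
  -- `Tfst (dσ 1) = d/ds (uDir b (circlePt s)) ≠ 0`
  have hcoe : HasDerivAt (fun s' : ℝ => ((uDir b (circlePt s') : sphere (0 : EuclideanSpace ℝ (Fin 2)) 1) :
      EuclideanSpace ℝ (Fin 2))) (uDirLin b ((-(2 * Real.pi * Real.sin (2 * Real.pi * s))) •
        EuclideanSpace.single (0 : Fin 2) (1 : ℝ) +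
        (2 * Real.pi * Real.cos (2 * Real.pi * s)) • EuclideanSpace.single (1 : Fin 2) (1 : ℝ))) s := by
    have h := (uDirLin b).hasFDerivAt.comp_hasDerivAt s (hasDerivAt_coe_circlePt s)
    exact h
  have hne : uDirLin b ((-(2 * Real.pi * Real.sin (2 * Real.pi * s))) • EuclideanSpace.single (0 : Fin 2) (1 : ℝ) +
      (2 * Real.pi * Real.cos (2 * Real.pi * s)) • EuclideanSpace.single (1 : Fin 2) (1 : ℝ)) ≠ 0 := by
    intro h0
    have ha : -(2 * Real.pi * Real.sin (2 * Real.pi * s)) = 0 := by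
      simpa [uDirLin_apply] using congrArg (fun v : EuclideanSpace ℝ (Fin 2) => v 0) h0
    have hc : slideSign b * (2 * Real.pi * Real.cos (2 * Real.pi * s)) = 0 := by
      simpa [uDirLin_apply] using congrArg (fun v : EuclideanSpace ℝ (Fin 2) => v 1) h0
    have hπ : (2 * Real.pi) ≠ 0 := by positivity
    have hσ : slideSign b ≠ 0 := fun h => by
      have := slideSign_mul_self b
      rw [h, mul_zero] at this
      exact zero_ne_one this
    have hsin : Real.sin (2 * Real.pi * s) = 0 := by
      rw [neg_eq_zero, mul_eq_zero] at ha
      exact ha.resolve_left hπ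
    have hcos : Real.cos (2 * Real.pi * s) = 0 := by
      rcases mul_eq_zero.1 hc with h | h
      · exact absurd h hσ
      · exact (mul_eq_zero.1 h).resolve_left hπ
    have hs2 := Real.sin_sq_add_cos_sq (2 * Real.pi * s)
    rw [hsin, hcos] at hs2
    norm_num at hs2
  have h1 : Tfst (mfderiv 𝓘(ℝ, ℝ) ((𝓡 1).prod 𝓘(ℝ, EuclideanSpace ℝ (Fin 2))) σ s 1) ≠ 0 := by
    have hc := mfderiv_comp s (hσ0 ▸ hfst_d q) ((hσs s).mdifferentiableAt (by simp))
    have e : mfderiv 𝓘(ℝ, ℝ) 𝓘(ℝ, EuclideanSpace ℝ (Fin 2))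
        ((fun q' : (sphere (0 : EuclideanSpace ℝ (Fin 2)) 1) × EuclideanSpace ℝ (Fin 2) =>
          ((q'.1 : EuclideanSpace ℝ (Fin 2)))) ∘ σ) s 1 =
        Tfst (mfderiv 𝓘(ℝ, ℝ) ((𝓡 1).prod 𝓘(ℝ, EuclideanSpace ℝ (Fin 2))) σ s 1) :=
      congrArg (fun T : ℝ →L[ℝ] EuclideanSpace ℝ (Fin 2) => T 1) hc
    have e2 : mfderiv 𝓘(ℝ, ℝ) 𝓘(ℝ, EuclideanSpace ℝ (Fin 2))
        ((fun q' : (sphere (0 : EuclideanSpace ℝ (Fin 2)) 1) × EuclideanSpace ℝ (Fin 2) =>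
          ((q'.1 : EuclideanSpace ℝ (Fin 2)))) ∘ σ) s 1 = uDirLin b ((-(2 * Real.pi * Real.sin (2 * Real.pi * s))) •
        EuclideanSpace.single (0 : Fin 2) (1 : ℝ) +
        (2 * Real.pi * Real.cos (2 * Real.pi * s)) • EuclideanSpace.single (1 : Fin 2) (1 : ℝ)) := by
      rw [show ((fun q' : (sphere (0 : EuclideanSpace ℝ (Fin 2)) 1) × EuclideanSpace ℝ (Fin 2) =>
          ((q'.1 : EuclideanSpace ℝ (Fin 2)))) ∘ σ) = fun s' : ℝ =>
          ((uDir b (circlePt s') : sphere (0 : EuclideanSpace ℝ (Fin 2)) 1) : EuclideanSpace ℝ (Fin 2)) from rfl]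
      exact mfderiv_apply_one_of_hasDerivAt hcoe
    rw [e2] at e
    rw [← e]
    exact hne
  have h2 : Tfst (mfderiv 𝓘(ℝ, ℝ) ((𝓡 1).prod 𝓘(ℝ, EuclideanSpace ℝ (Fin 2))) α 0 1) = 0 := by
    have hc := mfderiv_comp (0 : ℝ) (hα0 ▸ hfst_d q) ((hαs 0).mdifferentiableAt (by simp))
    have e : mfderiv 𝓘(ℝ, ℝ) 𝓘(ℝ, EuclideanSpace ℝ (Fin 2))
        ((fun q' : (sphere (0 : EuclideanSpace ℝ (Fin 2)) 1) × EuclideanSpace ℝ (Fin 2) =>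
          ((q'.1 : EuclideanSpace ℝ (Fin 2)))) ∘ α) 0 1 =
        mfderiv ((𝓡 1).prod 𝓘(ℝ, EuclideanSpace ℝ (Fin 2))) 𝓘(ℝ, EuclideanSpace ℝ (Fin 2))
          (fun q' : (sphere (0 : EuclideanSpace ℝ (Fin 2)) 1) × EuclideanSpace ℝ (Fin 2) =>
            ((q'.1 : EuclideanSpace ℝ (Fin 2)))) (α 0)
          (mfderiv 𝓘(ℝ, ℝ) ((𝓡 1).prod 𝓘(ℝ, EuclideanSpace ℝ (Fin 2))) α 0 1) :=
      congrArg (fun T : ℝ →L[ℝ] EuclideanSpace ℝ (Fin 2) => T 1) hc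
    have e2 : mfderiv 𝓘(ℝ, ℝ) 𝓘(ℝ, EuclideanSpace ℝ (Fin 2))
        ((fun q' : (sphere (0 : EuclideanSpace ℝ (Fin 2)) 1) × EuclideanSpace ℝ (Fin 2) =>
          ((q'.1 : EuclideanSpace ℝ (Fin 2)))) ∘ α) 0 1 = 0 := by
      rw [show ((fun q' : (sphere (0 : EuclideanSpace ℝ (Fin 2)) 1) × EuclideanSpace ℝ (Fin 2) =>
          ((q'.1 : EuclideanSpace ℝ (Fin 2)))) ∘ α) = fun _ : ℝ =>
          ((uDir b θ : sphere (0 : EuclideanSpace ℝ (Fin 2)) 1) : EuclideanSpace ℝ (Fin 2)) from rfl]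
      rw [mfderiv_const]; rfl
    have key : ∀ (q' : (sphere (0 : EuclideanSpace ℝ (Fin 2)) 1) × EuclideanSpace ℝ (Fin 2)) (_ : q' = q)
        (v : TangentSpace ((𝓡 1).prod 𝓘(ℝ, EuclideanSpace ℝ (Fin 2))) q'),
        mfderiv ((𝓡 1).prod 𝓘(ℝ, EuclideanSpace ℝ (Fin 2))) 𝓘(ℝ, EuclideanSpace ℝ (Fin 2))
          (fun q' : (sphere (0 : EuclideanSpace ℝ (Fin 2)) 1) × EuclideanSpace ℝ (Fin 2) =>
            ((q'.1 : EuclideanSpace ℝ (Fin 2)))) q' v = Tfst v := by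
      intro q' e' v; subst e'; rfl
    rw [e2, key _ hα0] at e
    exact e.symm
  -- the framing's fibre component is `ζ ≠ 0`, so the framing is non-zero
  have h3 : mfderiv 𝓘(ℝ, ℝ) ((𝓡 1).prod 𝓘(ℝ, EuclideanSpace ℝ (Fin 2))) α 0 1 ≠ 0 := by
    intro h0
    have hsnd : ContMDiff ((𝓡 1).prod 𝓘(ℝ, EuclideanSpace ℝ (Fin 2))) 𝓘(ℝ, EuclideanSpace ℝ (Fin 2)) ∞
        fun q' : (sphere (0 : EuclideanSpace ℝ (Fin 2)) 1) × EuclideanSpace ℝ (Fin 2) => q'.2 := contMDiff_snd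
    have hsnd_d : MDifferentiableAt ((𝓡 1).prod 𝓘(ℝ, EuclideanSpace ℝ (Fin 2))) 𝓘(ℝ, EuclideanSpace ℝ (Fin 2))
        (fun q' : (sphere (0 : EuclideanSpace ℝ (Fin 2)) 1) × EuclideanSpace ℝ (Fin 2) => q'.2) (α 0) :=
      (hsnd (α 0)).mdifferentiableAt (by simp)
    have hc := mfderiv_comp (0 : ℝ) hsnd_d ((hαs 0).mdifferentiableAt (by simp))
    have e : mfderiv 𝓘(ℝ, ℝ) 𝓘(ℝ, EuclideanSpace ℝ (Fin 2))
        ((fun q' : (sphere (0 : EuclideanSpace ℝ (Fin 2)) 1) × EuclideanSpace ℝ (Fin 2) => q'.2) ∘ α) 0 1 =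
        mfderiv ((𝓡 1).prod 𝓘(ℝ, EuclideanSpace ℝ (Fin 2))) 𝓘(ℝ, EuclideanSpace ℝ (Fin 2))
          (fun q' : (sphere (0 : EuclideanSpace ℝ (Fin 2)) 1) × EuclideanSpace ℝ (Fin 2) => q'.2) (α 0)
          (mfderiv 𝓘(ℝ, ℝ) ((𝓡 1).prod 𝓘(ℝ, EuclideanSpace ℝ (Fin 2))) α 0 1) :=
      congrArg (fun T : ℝ →L[ℝ] EuclideanSpace ℝ (Fin 2) => T 1) hc
    have e2 : mfderiv 𝓘(ℝ, ℝ) 𝓘(ℝ, EuclideanSpace ℝ (Fin 2))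
        ((fun q' : (sphere (0 : EuclideanSpace ℝ (Fin 2)) 1) × EuclideanSpace ℝ (Fin 2) => q'.2) ∘ α) 0 1 = ζ t θ := by
      have hline : HasDerivAt (fun ε : ℝ => w t θ + ε • ζ t θ) (ζ t θ) 0 := by
        simpa using ((hasDerivAt_id (0 : ℝ)).smul_const (ζ t θ)).const_add (w t θ)
      rw [show ((fun q' : (sphere (0 : EuclideanSpace ℝ (Fin 2)) 1) × EuclideanSpace ℝ (Fin 2) => q'.2) ∘ α) =
        fun ε : ℝ => w t θ + ε • ζ t θ from rfl]
      exact mfderiv_apply_one_of_hasDerivAt hline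
    rw [e2, h0, map_zero] at e
    exact hζ0 t θ e
  -- conclude
  rw [Submodule.mem_span_singleton, hvel, hfr]
  rintro ⟨c, hc⟩
  have hc2 := (L.map_smul c (mfderiv 𝓘(ℝ, ℝ) ((𝓡 1).prod 𝓘(ℝ, EuclideanSpace ℝ (Fin 2))) σ s 1)).trans hc
  have hc' := hLinj hc2
  -- apply `Tfst`: `c • (non-zero) = 0`, so `c = 0`, so the framing vanishes: contradiction
  have h4 := congrArg Tfst hc'
  rw [h2] at h4
  have h5 : c • Tfst (mfderiv 𝓘(ℝ, ℝ) ((𝓡 1).prod 𝓘(ℝ, EuclideanSpace ℝ (Fin 2))) σ s 1) = 0 :=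
    (Tfst.map_smul c _).symm.trans h4
  rcases smul_eq_zero.1 h5 with h6 | h6
  · rw [h6, zero_smul] at hc'
    exact h3 hc'.symm
  · exact h1 h6

include hw hζ hw1 hζ0 in
/-- **The tube-curve framings form a framing family carried along the tube-curve isotopy.**
[cite: Kosinski1993, VI §6] -/
theorem isFramingAlong_tubeCurve :
    IsFramingAlong (tubeCurveIsotopy Φ b hw hw1) (tubeCurveFraming Φ b w ζ 0) (tubeCurveFraming Φ b w ζ) where
  apply_zero := rfl
  isKnotFraming t _ :=
    { continuous := (continuous_tubeCurveFraming_uncurry Φ b hw hζ hw1).comp (Continuous.prodMk_right t)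
      mem_boundaryTangentSpace := fun θ => tubeCurveFraming_apply_zero Φ b hw1 t θ
      not_mem_span := fun s => tubeCurveFraming_not_mem_span Φ b hw hw1 hζ0 t s }
  continuousOn := (continuous_tubeCurveFraming_uncurry Φ b hw hζ hw1).continuousOn


/-! ### §4 Registered helper -/

/-- **Registered helper `helper_belt_tubeCurves` (node T3c-1 of NF6 `stub_steinRealisation`, tool for stage
(3d), wave 3, lead c5): for a tube `Φ` of `∂W`, a direction flag `b` and jointly smooth fibre families
`w, ζ : ℝ → 𝕊¹ → ℝ²` with `‖w‖ < 1`, `ζ ≠ 0`, the curves `θ ↦ Φ (uDir b θ, w t θ)` form an isotopy of knots in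
`∂W` carrying the framings `d/dε|₀ Φ (uDir b θ, w t θ + ε ζ t θ)`.** [cite: Kosinski1993, VI §6] -/
theorem helper_belt_tubeCurves :
    ∀ {W : Type} [TopologicalSpace W] [T2Space W] [ChartedSpace (EuclideanHalfSpace 4) W] [IsManifold (𝓡∂ 4) ∞ W]
      (Φ : Literature.Topology.FourManifolds.CircleTube ↥((𝓡∂ 4).boundary W)) (b : Bool)
      (w ζ : ℝ → Metric.sphere (0 : EuclideanSpace ℝ (Fin 2)) 1 → EuclideanSpace ℝ (Fin 2))
      (hw : ContMDiff (𝓘(ℝ, ℝ).prod (𝓡 1)) 𝓘(ℝ, EuclideanSpace ℝ (Fin 2)) ∞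
        fun p : ℝ × (Metric.sphere (0 : EuclideanSpace ℝ (Fin 2)) 1) => w p.1 p.2)
      (_ : ContMDiff (𝓘(ℝ, ℝ).prod (𝓡 1)) 𝓘(ℝ, EuclideanSpace ℝ (Fin 2)) ∞
        fun p : ℝ × (Metric.sphere (0 : EuclideanSpace ℝ (Fin 2)) 1) => ζ p.1 p.2)
      (hw1 : ∀ t θ, ‖w t θ‖ < 1) (_ : ∀ t θ, ζ t θ ≠ 0),
      (∀ t θ, Summit.SmoothPoincare4.SmoothPoincare4.Theorems.AcyclicBisectionExists.ModpBraidOrbits.tubeCurve Φ b w t θ = ((Φ.toHomeo (Summit.SmoothPoincare4.SmoothPoincare4.Theorems.AcyclicBisectionExists.ModpBraidOrbits.uDir b θ, w t θ) : ↥((𝓡∂ 4).boundary W)) : W)) ∧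
      (∀ t θ, Summit.SmoothPoincare4.SmoothPoincare4.Theorems.AcyclicBisectionExists.ModpBraidOrbits.tubeCurveFraming Φ b w ζ t θ = mfderiv 𝓘(ℝ, ℝ) (𝓡∂ 4)
        (fun ε : ℝ => ((Φ.toHomeo (Summit.SmoothPoincare4.SmoothPoincare4.Theorems.AcyclicBisectionExists.ModpBraidOrbits.uDir b θ, w t θ + ε • ζ t θ) : ↥((𝓡∂ 4).boundary W)) : W)) 0 (1 : ℝ)) ∧
      (∀ t, (Summit.SmoothPoincare4.SmoothPoincare4.Theorems.AcyclicBisectionExists.ModpBraidOrbits.tubeCurveIsotopy Φ b hw hw1).toFun t = Summit.SmoothPoincare4.SmoothPoincare4.Theorems.AcyclicBisectionExists.ModpBraidOrbits.tubeCurve Φ b w t) ∧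
      Literature.Geometry.Symplectic.IsFramingAlong (Summit.SmoothPoincare4.SmoothPoincare4.Theorems.AcyclicBisectionExists.ModpBraidOrbits.tubeCurveIsotopy Φ b hw hw1)
        (Summit.SmoothPoincare4.SmoothPoincare4.Theorems.AcyclicBisectionExists.ModpBraidOrbits.tubeCurveFraming Φ b w ζ 0) (Summit.SmoothPoincare4.SmoothPoincare4.Theorems.AcyclicBisectionExists.ModpBraidOrbits.tubeCurveFraming Φ b w ζ) := by
  intro W _ _ _ _ Φ b w ζ hw hζ hw1 hζ0
  exact ⟨fun t θ => rfl, fun t θ => rfl, fun t => rfl, isFramingAlong_tubeCurve Φ b hw hζ hw1 hζ0⟩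

end Summit.SmoothPoincare4.SmoothPoincare4.Theorems.AcyclicBisectionExists.ModpBraidOrbits

end
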